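import Literature.NumberTheory.Transcendental.RoySmallValueLinearFactors
import HarnessLib

/-!
# Roy's small value estimate for `𝔾ₐ × 𝔾ₘ` — heights of the linear factors of an integer polynomial: the lower bound

Topic `Literature/NumberTheory/Transcendental`. Part of the formalisation of the proof of Roy 2013,
Theorem 1.1 (named fact `roy2013_thm_1_1`, `RoySmallValueEstimates.lean`). Source: D. Roy,
*A small value estimate for `𝔾ₐ × 𝔾ₘ`*, Mathematika 59 (2013) 333–363 = arXiv:1301.0663, §2,
Proposition 2.3 (p. 7 of the arXiv text) and its use in §6, Proposition 6.2:

> `F(P) = a ∏_{α ∈ Z} P(α)` [...] Applying this estimate to the convex body `𝓑` [...] we get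
> `|h_𝓑(Z) − log|a|| ≤ 3 log(m+1) D deg(Z)` [...] `|log|a| − D h(Z)| ≤ 7 log(m+1) D deg(Z)`.

The height of a zero-dimensional cycle enters the proof of Theorem 1.1 with a favourable sign in
Step 2 (through Prop. 6.2: `h_𝒞(Z) ≤ −C''(Y deg(Z) + D h(Z))`) because the leading constant `a` of
the Chow form is LARGE when the points have large height (`log|a| ≥ D h(Z) − O(D deg Z)`, half of
Prop. 2.3). In this development the same mechanism is the following exact companion of the
Gelfond–Mahler inequality of `RoySmallValueLinearFactors` (`prod_mulHeight_pow_le`, an upper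
bound by `L(F₀)^{[K:ℚ]}`): if `F₀ ∈ ℤ[r] ∖ {0}` factors over the number field `K` as
`F₀ = a ∏_j ℓ_j^{e_j}`, `ℓ_j = ∑_i c_{ji} r_i`, then

  `∏_j H_K(c_j)^{e_j} ≤ ∏_{σ : K → ℂ} ( |σ a| ∏_j (max_i |σ c_{ji}|)^{e_j} )`

(`prod_mulHeight_pow_le_prod_embeddings`, and its logarithmic form): the finite places
contribute `≤ 1` by Gauss's lemma and the product formula moves `a` to the archimedean side, where
each factor `|σa| ∏ (max|σc|)^e` is the modulus of the leading constant of `σF₀ = F₀` written as a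
product of SUP-NORMALISED linear forms. The proof is the computation of `prod_mulHeight_pow_le`
(seat B) with its last (archimedean) step removed. Everything is proved; no definitions, no named
facts.

## References

* [Roy2013] D. Roy, *A small value estimate for 𝔾ₐ × 𝔾ₘ*, Mathematika 59 (2013), 333–363
  (arXiv:1301.0663), Proposition 2.3 (the estimate `|log|a| − D h(Z)| ≤ …`) and Prop. 6.2.
-/

noncomputable section

open MvPolynomial NumberField Height Finset

namespace Literature.NumberTheory.Transcendental

namespace Roy2013

variable {K : Type*} [Field K] [NumberField K] {ι : Type*} [Fintype ι] {J : Type*} [Fintype J]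

/-- **The lower bound for the leading constant** (companion of the Gelfond–Mahler inequality): if
`F₀ = a ∏_j ℓ_j^{e_j}` over `K` with `ℓ_j = ∑_i c_{ji} X_i`, `c_j ≠ 0`, `F₀ ∈ ℤ[X] ∖ {0}`, then
`∏_j H_K(c_j)^{e_j} ≤ ∏_{σ : K → ℂ} |σ a| ∏_j (max_i |σ c_{ji}|)^{e_j}`.
[cite: Roy2013, Proposition 2.3 (proof: `|log|a| − D h(Z)| ≤ 7 log(m+1) D deg Z`), here exact] -/
theorem prod_mulHeight_pow_le_prod_embeddings [LinearOrder ι] {F₀ : MvPolynomial ι ℤ}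
    (hF₀ : F₀ ≠ 0) {a : K} {c : J → ι → K} (hc : ∀ j, c j ≠ 0) {e : J → ℕ}
    (hfac : map (Int.castRingHom K) F₀ = C a * ∏ j, (∑ i, C (c j i) * X i) ^ e j) :
    ∏ j, mulHeight (c j) ^ e j ≤
      ∏ σ : K →+* ℂ, (‖σ a‖ * ∏ j, (⨆ i, ‖σ (c j i)‖) ^ e j) := by
  classical
  -- `a ≠ 0`
  have ha : a ≠ 0 := by
    rintro rfl
    rw [C_0, zero_mul] at hfac
    exact hF₀ (map_injective _ Int.cast_injective (by rw [hfac, map_zero]))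
  -- local quantities
  set N : InfinitePlace K → J → ℝ := fun v j => ⨆ i, v (c j i) with hN
  set M : FinitePlace K → J → ℝ := fun w j => ⨆ i, w (c j i) with hM
  have hNnn : ∀ v j, 0 ≤ N v j := fun v j => Real.iSup_nonneg fun i => apply_nonneg _ _
  have hMnn : ∀ w j, 0 ≤ M w j := fun w j => Real.iSup_nonneg fun i => apply_nonneg _ _
  have hMfin : ∀ j, (fun w : FinitePlace K => M w j).HasFiniteMulSupport := fun j =>
    hasFiniteMulSupport_iSup_finitePlace' (hc j)
  have hMfin' : ∀ j, (fun w : FinitePlace K => M w j ^ e j).HasFiniteMulSupport := fun j =>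
    (hMfin j).pow (e j)
  -- heights of the `c_j`
  have hH : ∀ j, mulHeight (c j) = (∏ v : InfinitePlace K, N v j ^ v.mult) *
      ∏ᶠ w : FinitePlace K, M w j := fun j => NumberField.mulHeight_eq (hc j)
  -- the product of the heights, split into infinite and finite parts
  have hsplit : ∏ j, mulHeight (c j) ^ e j =
      (∏ v : InfinitePlace K, (∏ j, N v j ^ e j) ^ v.mult) *
        ∏ᶠ w : FinitePlace K, ∏ j, M w j ^ e j := by
    simp_rw [hH, mul_pow, prod_mul_distrib]
    congr 1
    · have h1 : ∀ j, (∏ v : InfinitePlace K, N v j ^ v.mult) ^ e j =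
          ∏ v : InfinitePlace K, (N v j ^ e j) ^ v.mult := fun j => by
        rw [← prod_pow]
        refine prod_congr rfl fun v _ => ?_
        rw [← pow_mul, ← pow_mul, mul_comm]
      have h2 : ∀ v : InfinitePlace K, (∏ j, N v j ^ e j) ^ v.mult =
          ∏ j, (N v j ^ e j) ^ v.mult := fun v => (prod_pow _ _ _).symm
      simp_rw [h1, h2]
      exact prod_comm
    · have h1 : ∀ j, (∏ᶠ w : FinitePlace K, M w j) ^ e j = ∏ᶠ w : FinitePlace K, M w j ^ e j :=
        fun j => finprod_pow (hMfin j) (e j)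
      simp_rw [h1]
      exact prod_finprod_comm univ (fun j w => M w j ^ e j) fun j _ => hMfin' j
  -- the product formula for `a`
  have hpf := prod_abs_eq_one ha
  -- infinite part: `∏_v (v a ∏_j N v j^{e_j})^{mult v} = ∏_σ (…)`
  have hinf : (∏ v : InfinitePlace K, v a ^ v.mult) *
      ∏ v : InfinitePlace K, (∏ j, N v j ^ e j) ^ v.mult =
      ∏ σ : K →+* ℂ, (‖σ a‖ * ∏ j, (⨆ i, ‖σ (c j i)‖) ^ e j) := by
    rw [← prod_mul_distrib]
    rw [← Finset.prod_fiberwise univ (fun σ : K →+* ℂ => InfinitePlace.mk σ)]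
    refine prod_congr rfl fun v _ => ?_
    rw [← mul_pow, ← InfinitePlace.card_filter_mk_eq v, ← prod_const]
    refine prod_congr rfl fun σ hσ => ?_
    rw [mem_filter] at hσ
    rw [← hσ.2]
    rfl
  -- finite part: `∏ᶠ_w (w a ∏_j M w j^{e_j}) ≤ 1`
  have hfinprod : (∏ᶠ w : FinitePlace K, w a) * ∏ᶠ w : FinitePlace K, ∏ j, M w j ^ e j ≤ 1 := by
    have hfs : (fun w : FinitePlace K => ∏ j, M w j ^ e j).HasFiniteMulSupport :=
      Function.HasFiniteMulSupport.prod (fun j => hMfin' j) univ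
    rw [← finprod_mul_distrib (FinitePlace.hasFiniteMulSupport ha) hfs]
    have key : ∀ w : FinitePlace K,
        (0 : ℝ) ≤ w a * ∏ j, M w j ^ e j ∧ w a * ∏ j, M w j ^ e j ≤ 1 := fun w =>
      ⟨mul_nonneg (apply_nonneg _ _) (prod_nonneg fun j _ => pow_nonneg (hMnn w j) _),
        finitePlace_mul_prod_iSup_le w hfac⟩
    have hind := finprod_induction (p := fun r : ℝ => 0 ≤ r ∧ r ≤ 1) ⟨zero_le_one, le_rfl⟩
      (fun r t hr ht => ⟨mul_nonneg hr.1 ht.1, mul_le_one₀ hr.2 ht.1 ht.2⟩) key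
    exact hind.2
  -- assemble
  have hfin_nn : 0 ≤ ∏ᶠ w : FinitePlace K, ∏ j, M w j ^ e j :=
    finprod_nonneg fun w => prod_nonneg fun j _ => pow_nonneg (hMnn w j) _
  have hinf_nn : 0 ≤ (∏ v : InfinitePlace K, v a ^ v.mult) *
      ∏ v : InfinitePlace K, (∏ j, N v j ^ e j) ^ v.mult :=
    mul_nonneg (prod_nonneg fun v _ => pow_nonneg (apply_nonneg _ _) _)
      (prod_nonneg fun v _ => pow_nonneg (prod_nonneg fun j _ => pow_nonneg (hNnn v j) _) _)
  calc ∏ j, mulHeight (c j) ^ e j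
      = ((∏ v : InfinitePlace K, (∏ j, N v j ^ e j) ^ v.mult) *
          ∏ᶠ w : FinitePlace K, ∏ j, M w j ^ e j) *
          ((∏ v : InfinitePlace K, v a ^ v.mult) * ∏ᶠ w : FinitePlace K, w a) := by
        rw [hsplit, hpf, mul_one]
    _ = ((∏ v : InfinitePlace K, v a ^ v.mult) *
          ∏ v : InfinitePlace K, (∏ j, N v j ^ e j) ^ v.mult) *
          ((∏ᶠ w : FinitePlace K, w a) * ∏ᶠ w : FinitePlace K, ∏ j, M w j ^ e j) := by ring
    _ ≤ ((∏ v : InfinitePlace K, v a ^ v.mult) *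
          ∏ v : InfinitePlace K, (∏ j, N v j ^ e j) ^ v.mult) * 1 :=
        mul_le_mul_of_nonneg_left hfinprod hinf_nn
    _ = _ := by rw [mul_one, hinf]

/-- **Logarithmic form of the lower bound**: `∑_j e_j h_K(c_j) ≤ ∑_σ log(|σa| ∏_j (max_i|σc_{ji}|)^{e_j})`.
[cite: Roy2013, Proposition 2.3 (`log|a| ≥ D h(Z) − 7 log(m+1) D deg Z`), here exact] -/
theorem sum_mul_logHeight_le_sum_embeddings [LinearOrder ι] {F₀ : MvPolynomial ι ℤ}
    (hF₀ : F₀ ≠ 0) {a : K} {c : J → ι → K} (hc : ∀ j, c j ≠ 0) {e : J → ℕ}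
    (hfac : map (Int.castRingHom K) F₀ = C a * ∏ j, (∑ i, C (c j i) * X i) ^ e j) :
    ∑ j, (e j : ℝ) * logHeight (c j) ≤
      ∑ σ : K →+* ℂ, Real.log (‖σ a‖ * ∏ j, (⨆ i, ‖σ (c j i)‖) ^ e j) := by
  classical
  have h := prod_mulHeight_pow_le_prod_embeddings hF₀ hc hfac
  -- all factors on the right are positive
  have ha : a ≠ 0 := by
    rintro rfl
    rw [C_0, zero_mul] at hfac
    exact hF₀ (map_injective _ Int.cast_injective (by rw [hfac, map_zero]))
  have hpos : ∀ σ : K →+* ℂ, 0 < ‖σ a‖ * ∏ j, (⨆ i, ‖σ (c j i)‖) ^ e j := by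
    intro σ
    refine mul_pos (norm_pos_iff.mpr ((map_ne_zero σ).mpr ha)) (prod_pos fun j _ => pow_pos ?_ _)
    obtain ⟨i, hi⟩ := Function.ne_iff.mp (hc j)
    have h1 : 0 < ‖σ (c j i)‖ := norm_pos_iff.mpr ((map_ne_zero σ).mpr hi)
    exact lt_of_lt_of_le h1 (le_ciSup (Finite.bddAbove_range fun i => ‖σ (c j i)‖) i)
  have hlhs : Real.log (∏ j, mulHeight (c j) ^ e j) = ∑ j, (e j : ℝ) * logHeight (c j) := by
    rw [Real.log_prod (fun j _ => (pow_pos (mulHeight_pos _) _).ne')]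
    exact Finset.sum_congr rfl fun j _ => by rw [Real.log_pow, logHeight_eq_log_mulHeight]
  rw [← hlhs, ← Real.log_prod (fun σ _ => (hpos σ).ne')]
  exact Real.log_le_log (prod_pos fun j _ => pow_pos (mulHeight_pos _) _) h

end Roy2013

end Literature.NumberTheory.Transcendental
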